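import Mathlib
import Summits.Ventures.HodgeRepro.OcticCMPointTruncModel

/-!
# OcticCMPointTruncTwist — an explicit primitive twist of conductor exactly `c` on `𝒪/𝔭^c`, `2 ≤ c ≤ 4`

Blind re-derivation cell `pub-hodge-repro`, seat night-2 (gen 4).  Target tree path
`lean/Summits/Ventures/HodgeRepro/OcticCMPointTruncTwist.lean`.  Continues `OcticCMPointTruncModel.lean`
(the ring `Trunc k c = k[ϖ]/(ϖ^c)` at the ramified places `𝔭₁, 𝔭₂ | 5` of the octic point).

ROUTE-B §9.9 (d) / gen 1 (`PeriodCloserC7Stability.lean`) twist the four lines by ONE character `ρ` of conductor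
exactly `c` with `ρ(1 + z) = ψ̃(a z)` on `I = 𝔭^{⌈c/2⌉}/𝔭^c` (`Primitive ψ̃ I ρ a`), the lines being shallow
(`Shallow ψ̃ I χ`, conductor `≤ c/2`).  Here such a `ρ` is CONSTRUCTED on the transcribed ring:

* `trLog z = z − ½ z² + ⅓ z³` — the truncated logarithm on `𝔪`; `trLog_mul` — `(1 + z)(1 + w) = 1 + u` gives
  `trLog u = trLog z + trLog w` for `z, w ∈ 𝔪` and `c ≤ 4` (the error is `ϖ^4 · (…)`), for `2, 3 ≠ 0` in `k`;
* `twist θ ψ₀` — the character `x ↦ θ(x₀) · ψ₀((trLog(x/x₀ − 1))_{c−1})` of `(𝒪/𝔭^c)^×` (tame part `θ` on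
  the constant term `x₀ ∈ k^×`, wild part through the top coefficient of the logarithm), `0` off the units;
* **`primitive_twist`** — `twist θ ψ₀` is a primitive twist in gen 1's sense on `I = (ϖ^m)` for `2m ≥ c`, with
  `a = 1`: `ρ(1 + z) = ψ̃(z)` for `z ∈ I` (there `z² = 0`, so `trLog z = z`);
* **`twist_conductor`** — it is non-trivial on `1 + (ϖ^{c−1})` (conductor exactly `c`: `hprim` of the product
  formula) when `ψ₀` is primitive;
* `shallow_tame` — the tame characters `x ↦ θ(x₀)` are shallow (conductor `≤ 1 ≤ c/2`).

So the hypotheses `hρ`, `hχ` of `E3_of_N2_trunc` (`OcticCMPointTruncModel.lean`) are discharged for the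
explicit twist and tame lines: **`E3_twisted_tame`** — (E3) at `𝔭 | 5` for the four tame lines twisted by
`twist θ ψ₀` follows from N2, with no stability hypothesis left.

**What this is not.**  The route's `ρ` is a global Hecke character with these local components (its existence
is ROUTE-B §9.12 (c), not here); the four `χ′_j` of the octic face are on no page; `c ≥ 5` and `𝔮 | 2` are not
covered.  Nothing here says anything about the status of the Hodge conjecture for CM abelian varieties, which is
NOT proved.
-/

set_option autoImplicit false

noncomputable section

open Finset Polynomial

namespace Summit.Ventures.HodgeRepro.PeriodCloser

open GaussSumStability

namespace TruncModel

variable {k : Type} [Field k] (c : ℕ)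

/-! ### The truncated logarithm -/

/-- **The truncated logarithm** `z ↦ z − ½ z² + ⅓ z³` (exact on `𝔪` for `c ≤ 4`). -/
def trLog (z : Trunc k c) : Trunc k c :=
  z - algebraMap k (Trunc k c) (2 : k)⁻¹ * z ^ 2 + algebraMap k (Trunc k c) (3 : k)⁻¹ * z ^ 3

/-- `ϖ^4 = 0` for `c ≤ 4`. -/
theorem varpi_pow_four (hc : c ≤ 4) : (varpi c : Trunc k c) ^ 4 = 0 := by
  rw [show (4 : ℕ) = c + (4 - c) by omega, pow_add, varpi_pow_c, zero_mul]

/-- **The logarithm is a homomorphism** `1 + 𝔪 → 𝔪` for `c ≤ 4`: `trLog (z + w + z w) = trLog z + trLog w`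
for `z, w ∈ 𝔪` — the difference is `ϖ^4` times an explicit polynomial. -/
theorem trLog_mul (hc : c ≤ 4) (h2 : (2 : k) ≠ 0) (h3 : (3 : k) ≠ 0) {z w : Trunc k c} (hz : z ∈ maxIdeal c)
    (hw : w ∈ maxIdeal c) : trLog c (z + w + z * w) = trLog c z + trLog c w := by
  obtain ⟨z', rfl⟩ := Ideal.mem_span_singleton.1 hz
  obtain ⟨w', rfl⟩ := Ideal.mem_span_singleton.1 hw
  have h4 : (varpi c : Trunc k c) ^ 4 = 0 := varpi_pow_four c hc
  have h2' : (2 : Trunc k c) * algebraMap k (Trunc k c) (2 : k)⁻¹ = 1 := by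
    rw [← map_ofNat (algebraMap k (Trunc k c)) 2, ← map_mul, mul_inv_cancel₀ h2, map_one]
  have h3' : (3 : Trunc k c) * algebraMap k (Trunc k c) (3 : k)⁻¹ = 1 := by
    rw [← map_ofNat (algebraMap k (Trunc k c)) 3, ← map_mul, mul_inv_cancel₀ h3, map_one]
  unfold trLog
  set h := algebraMap k (Trunc k c) (2 : k)⁻¹
  set t := algebraMap k (Trunc k c) (3 : k)⁻¹
  linear_combination (-h * z' ^ 2 * w' ^ 2 + t * (3 * z' ^ 3 * w' + 6 * z' ^ 2 * w' ^ 2 + 3 * z' * w' ^ 3) +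
    varpi c * t * (3 * z' ^ 3 * w' ^ 2 + 3 * z' ^ 2 * w' ^ 3) + varpi c ^ 2 * t * (z' ^ 3 * w' ^ 3)) * h4 +
    (-(varpi c ^ 2 * z' * w') - varpi c ^ 3 * (z' * w' ^ 2 + z' ^ 2 * w')) * h2' +
    (varpi c ^ 3 * (z' * w' ^ 2 + z' ^ 2 * w')) * h3'

/-- `trLog z = z` when `z² = 0` (on `I = (ϖ^m)`, `2m ≥ c`). -/
theorem trLog_of_sq_eq_zero {z : Trunc k c} (hz : z ^ 2 = 0) : trLog c z = z := by
  unfold trLog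
  rw [hz, pow_succ, hz, zero_mul, mul_zero, mul_zero, sub_zero, add_zero]

/-- `z ∈ 𝔪` when `z ∈ (ϖ^m)`, `m ≥ 1`. -/
theorem mem_maxIdeal_of_mem_span_pow {m : ℕ} (hm : 1 ≤ m) {z : Trunc k c}
    (hz : z ∈ Ideal.span {(varpi c : Trunc k c) ^ m}) : z ∈ maxIdeal c := by
  obtain ⟨y, rfl⟩ := Ideal.mem_span_singleton.1 hz
  rw [maxIdeal, Ideal.mem_span_singleton]
  exact ⟨varpi c ^ (m - 1) * y, by rw [← mul_assoc, ← pow_succ', show m - 1 + 1 = m by omega]⟩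

/-! ### The constant term and the reduced unit -/

/-- The constant term is multiplicative (`c > 0`). -/
theorem coeffAt_zero_mul (hc : 0 < c) (x y : Trunc k c) : coeffAt c 0 (x * y) = coeffAt c 0 x * coeffAt c 0 y := by
  obtain ⟨p, rfl⟩ := AdjoinRoot.mk_surjective x
  obtain ⟨q, rfl⟩ := AdjoinRoot.mk_surjective y
  rw [← map_mul, coeffAt_mk_of_lt c _ hc, coeffAt_mk_of_lt c _ hc, coeffAt_mk_of_lt c _ hc, mul_coeff_zero]

/-- `coeffAt 0 1 = 1` (`c > 0`). -/
theorem coeffAt_zero_one (hc : 0 < c) : coeffAt c 0 (1 : Trunc k c) = 1 := by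
  rw [← map_one (mk c), coeffAt_mk_of_lt c _ hc, coeff_one_zero]

/-- `coeffAt 0 (algebraMap a) = a` (`c > 0`). -/
theorem coeffAt_zero_algebraMap (hc : 0 < c) (a : k) : coeffAt c 0 (algebraMap k (Trunc k c) a) = a := by
  rw [AdjoinRoot.algebraMap_eq, ← AdjoinRoot.mk_C, coeffAt_mk_of_lt c _ hc, coeff_C_zero]

/-- The constant term of a unit is non-zero (`c > 0`). -/
theorem coeffAt_zero_ne_zero_of_isUnit (hc : 0 < c) {x : Trunc k c} (hx : IsUnit x) : coeffAt c 0 x ≠ 0 := by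
  intro h0
  exact (hloc c hc x).1 ((mem_maxIdeal_iff_coeff c hc x).2 h0) hx

/-- **The reduced unit** `x/x₀ − 1 ∈ 𝔪` of `x` (`x₀` its constant term). -/
def red (x : Trunc k c) : Trunc k c := algebraMap k (Trunc k c) (coeffAt c 0 x)⁻¹ * x - 1

/-- `red x ∈ 𝔪` for a unit `x` (`c > 0`). -/
theorem red_mem (hc : 0 < c) {x : Trunc k c} (hx : IsUnit x) : red c x ∈ maxIdeal c := by
  rw [mem_maxIdeal_iff_coeff c hc, red, map_sub, ← Algebra.smul_def, map_smul, smul_eq_mul,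
    coeffAt_zero_one c hc, inv_mul_cancel₀ (coeffAt_zero_ne_zero_of_isUnit c hc hx), sub_self]

/-- `x = x₀ (1 + red x)` for a unit `x` (`c > 0`). -/
theorem eq_algebraMap_mul_one_add_red (hc : 0 < c) {x : Trunc k c} (hx : IsUnit x) :
    x = algebraMap k (Trunc k c) (coeffAt c 0 x) * (1 + red c x) := by
  rw [red, add_sub_cancel, ← mul_assoc, ← map_mul, mul_inv_cancel₀ (coeffAt_zero_ne_zero_of_isUnit c hc hx),
    map_one, one_mul]

/-- `red (1 + z) = z` for `z ∈ 𝔪` (`c > 0`). -/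
theorem red_one_add (hc : 0 < c) {z : Trunc k c} (hz : z ∈ maxIdeal c) : red c (1 + z) = z := by
  rw [red, map_add, coeffAt_zero_one c hc, (mem_maxIdeal_iff_coeff c hc z).1 hz, add_zero, inv_one, map_one,
    one_mul, add_sub_cancel_left]

/-- `red (x y) = red x + red y + red x · red y` for units `x, y` (`c > 0`). -/
theorem red_mul (hc : 0 < c) {x y : Trunc k c} (hx : IsUnit x) (hy : IsUnit y) :
    red c (x * y) = red c x + red c y + red c x * red c y := by
  have h : (1 : Trunc k c) + red c (x * y) = (1 + red c x) * (1 + red c y) := by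
    have hx0 := coeffAt_zero_ne_zero_of_isUnit c hc hx
    have hy0 := coeffAt_zero_ne_zero_of_isUnit c hc hy
    have e := eq_algebraMap_mul_one_add_red c hc (hx.mul hy)
    rw [coeffAt_zero_mul c hc] at e
    have ex := eq_algebraMap_mul_one_add_red c hc hx
    have ey := eq_algebraMap_mul_one_add_red c hc hy
    have key : algebraMap k (Trunc k c) (coeffAt c 0 x * coeffAt c 0 y) * (1 + red c (x * y)) =
        algebraMap k (Trunc k c) (coeffAt c 0 x * coeffAt c 0 y) * ((1 + red c x) * (1 + red c y)) := by
      rw [← e, map_mul]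
      conv_lhs => rw [ex, ey]
      ring
    have hu : IsUnit (algebraMap k (Trunc k c) (coeffAt c 0 x * coeffAt c 0 y)) :=
      (isUnit_iff_ne_zero.2 (mul_ne_zero hx0 hy0)).map _
    exact hu.mul_left_cancel key
  linear_combination h

/-! ### The twist -/

/-- `red 1 = 0` (`c > 0`). -/
theorem red_one (hc : 0 < c) : red c (1 : Trunc k c) = 0 := by
  rw [red, coeffAt_zero_one c hc, inv_one, map_one, one_mul, sub_self]

/-- `1 + z` is a unit for `z ∈ 𝔪` (`c > 0`). -/
theorem isUnit_one_add (hc : 0 < c) {z : Trunc k c} (hz : z ∈ maxIdeal c) : IsUnit (1 + z) := by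
  by_contra h
  have := (hloc c hc _).2 h
  rw [mem_maxIdeal_iff_coeff c hc, map_add, coeffAt_zero_one c hc, (mem_maxIdeal_iff_coeff c hc z).1 hz,
    add_zero] at this
  exact one_ne_zero this

/-- The top coefficient of `y · ϖ^{c−1}` is the constant term of `y` (`c > 0`). -/
theorem coeffAt_mul_varpi_pow (hc : 0 < c) (y : Trunc k c) :
    coeffAt c (c - 1) (y * varpi c ^ (c - 1)) = coeffAt c 0 y := by
  obtain ⟨p, rfl⟩ := AdjoinRoot.mk_surjective y
  rw [varpi, ← AdjoinRoot.mk_X, ← map_pow, ← map_mul, coeffAt_mk_of_lt c _ (sub_one_lt c hc),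
    coeffAt_mk_of_lt c _ hc]
  have h := coeff_mul_X_pow p (c - 1) 0
  rwa [zero_add] at h

open scoped Classical in
/-- **The twist** `ρ = twist θ ψ₀`: `x ↦ θ(x₀) · ψ₀((trLog (red x))_{c−1})` on the units, `0` elsewhere
(`0 < c ≤ 4`, `2, 3 ≠ 0` in `k`). -/
def twist (hc : 0 < c) (hc4 : c ≤ 4) (h2 : (2 : k) ≠ 0) (h3 : (3 : k) ≠ 0) (θ : MulChar k ℂ)
    (ψ₀ : AddChar k ℂ) : MulChar (Trunc k c) ℂ where
  toFun x := if IsUnit x then θ (coeffAt c 0 x) * ψ₀ (coeffAt c (c - 1) (trLog c (red c x))) else 0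
  map_one' := by
    simp only [isUnit_one, if_true, coeffAt_zero_one c hc, MulChar.map_one, red_one c hc]
    rw [trLog_of_sq_eq_zero c (by rw [zero_pow two_ne_zero]), map_zero, AddChar.map_zero_eq_one, mul_one]
  map_mul' x y := by
    by_cases hx : IsUnit x
    · by_cases hy : IsUnit y
      · simp only [hx, hy, hx.mul hy, if_true]
        rw [coeffAt_zero_mul c hc, map_mul, red_mul c hc hx hy,
          trLog_mul c hc4 h2 h3 (red_mem c hc hx) (red_mem c hc hy), map_add, AddChar.map_add_eq_mul]
        ring
      · have hxy : ¬ IsUnit (x * y) := fun h => hy (isUnit_of_mul_isUnit_right h)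
        simp only [hxy, hy, if_false, mul_zero]
    · have hxy : ¬ IsUnit (x * y) := fun h => hx (isUnit_of_mul_isUnit_left h)
      simp only [hxy, hx, if_false, zero_mul]
  map_nonunit' x hx := by
    simp only [hx, if_false]

open scoped Classical in
/-- The value of the twist. -/
theorem twist_apply (hc : 0 < c) (hc4 : c ≤ 4) (h2 : (2 : k) ≠ 0) (h3 : (3 : k) ≠ 0) (θ : MulChar k ℂ)
    (ψ₀ : AddChar k ℂ) (x : Trunc k c) :
    twist c hc hc4 h2 h3 θ ψ₀ x =
      if IsUnit x then θ (coeffAt c 0 x) * ψ₀ (coeffAt c (c - 1) (trLog c (red c x))) else 0 := rfl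

/-- The value of the twist on `1 + z`, `z ∈ 𝔪`: `ψ₀((trLog z)_{c−1})`. -/
theorem twist_one_add (hc : 0 < c) (hc4 : c ≤ 4) (h2 : (2 : k) ≠ 0) (h3 : (3 : k) ≠ 0) (θ : MulChar k ℂ)
    (ψ₀ : AddChar k ℂ) {z : Trunc k c} (hz : z ∈ maxIdeal c) :
    twist c hc hc4 h2 h3 θ ψ₀ (1 + z) = ψ₀ (coeffAt c (c - 1) (trLog c z)) := by
  rw [twist_apply, if_pos (isUnit_one_add c hc hz), map_add, coeffAt_zero_one c hc,
    (mem_maxIdeal_iff_coeff c hc z).1 hz, add_zero, MulChar.map_one, one_mul, red_one_add c hc hz]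

/-- **The twist is primitive in gen 1's sense** (`Primitive ψ̃ I ρ a`, `PeriodCloserC7Stability.lean`) on
`I = (ϖ^m)`, `c ≤ 2m`, `1 ≤ m`, with `a = 1`: `ρ(1 + z) = ψ̃(z)` for `z ∈ I` (`trLog z = z` as `z² = 0`). -/
theorem primitive_twist (hc : 0 < c) (hc4 : c ≤ 4) (h2 : (2 : k) ≠ 0) (h3 : (3 : k) ≠ 0) (θ : MulChar k ℂ)
    (ψ₀ : AddChar k ℂ) (piVal : ℂ) (m : ℕ) (hm : c ≤ 2 * m) (hm1 : 1 ≤ m) :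
    LocalChar.Primitive (psiTilde c ψ₀) (Ideal.span {(varpi c : Trunc k c) ^ m})
      (⟨twist c hc hc4 h2 h3 θ ψ₀, piVal⟩ : LocalChar (Trunc k c)) 1 := by
  intro z hz
  change twist c hc hc4 h2 h3 θ ψ₀ (1 + z) = psiTilde c ψ₀ (((1 : (Trunc k c)ˣ) : Trunc k c) * z)
  rw [Units.val_one, one_mul, twist_one_add c hc hc4 h2 h3 θ ψ₀ (mem_maxIdeal_of_mem_span_pow c hm1 hz),
    trLog_of_sq_eq_zero c (by rw [sq]; exact pow_mul_eq_zero_of_le c m hm z hz z hz), psiTilde_apply]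

/-- **Conductor exactly `c`** (the hypothesis `hprim` of the product formula, `OcticCMPointDeepSign.lean`): the
twist is non-trivial on `1 + (ϖ^{c−1})` for a primitive `ψ₀` (`c ≥ 2`): `ρ(1 + t ϖ^{c−1}) = ψ₀(t)`. -/
theorem twist_conductor (hc : 2 ≤ c) (hc4 : c ≤ 4) (h2 : (2 : k) ≠ 0) (h3 : (3 : k) ≠ 0) (θ : MulChar k ℂ)
    (ψ₀ : AddChar k ℂ) (h₀ : ψ₀.IsPrimitive) :
    ∃ z₀, PsiAnn (psiTilde c ψ₀) (maxIdeal c) z₀ ∧ twist c (by omega) hc4 h2 h3 θ ψ₀ (1 + z₀) ≠ 1 := by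
  obtain ⟨t, ht⟩ := AddChar.ne_one_iff.1 (by simpa only [AddChar.mulShift_one] using h₀ one_ne_zero)
  refine ⟨algebraMap k (Trunc k c) t * varpi c ^ (c - 1), ?_, ?_⟩
  · intro z hz
    have hmul : algebraMap k (Trunc k c) t * varpi c ^ (c - 1) * z = 0 := by
      obtain ⟨y, rfl⟩ := Ideal.mem_span_singleton.1 hz
      calc algebraMap k (Trunc k c) t * varpi c ^ (c - 1) * (varpi c * y) =
          algebraMap k (Trunc k c) t * y * (varpi c ^ (c - 1) * varpi c) := by ring
        _ = 0 := by rw [← pow_succ, show c - 1 + 1 = c by omega, varpi_pow_c, mul_zero]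
    rw [hmul, AddChar.map_zero_eq_one]
  · have hz : algebraMap k (Trunc k c) t * varpi c ^ (c - 1) ∈ maxIdeal c := by
      rw [maxIdeal, Ideal.mem_span_singleton]
      exact ⟨algebraMap k (Trunc k c) t * varpi c ^ (c - 2), by
        rw [show c - 1 = (c - 2) + 1 by omega, pow_succ]; ring⟩
    rw [twist_one_add c (by omega) hc4 h2 h3 θ ψ₀ hz, trLog_of_sq_eq_zero c (by
      rw [mul_pow, ← pow_mul, show (c - 1) * 2 = c + (c - 2) by omega, pow_add, varpi_pow_c, zero_mul,
        mul_zero]), coeffAt_mul_varpi_pow c (by omega), coeffAt_zero_algebraMap c (by omega)]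
    exact ht

/-! ### The tame lines are shallow -/

open scoped Classical in
/-- **A tame character** `x ↦ θ(x₀)` of `(𝒪/𝔭^c)^×` (conductor `≤ 1`). -/
def tame (hc : 0 < c) (θ : MulChar k ℂ) : MulChar (Trunc k c) ℂ where
  toFun x := if IsUnit x then θ (coeffAt c 0 x) else 0
  map_one' := by simp only [isUnit_one, if_true, coeffAt_zero_one c hc, MulChar.map_one]
  map_mul' x y := by
    by_cases hx : IsUnit x
    · by_cases hy : IsUnit y
      · simp only [hx, hy, hx.mul hy, if_true, coeffAt_zero_mul c hc, map_mul]
      · have hxy : ¬ IsUnit (x * y) := fun h => hy (isUnit_of_mul_isUnit_right h)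
        simp only [hxy, hy, if_false, mul_zero]
    · have hxy : ¬ IsUnit (x * y) := fun h => hx (isUnit_of_mul_isUnit_left h)
      simp only [hxy, hx, if_false, zero_mul]
  map_nonunit' x hx := by simp only [hx, if_false]

open scoped Classical in
/-- The value of a tame character. -/
theorem tame_apply (hc : 0 < c) (θ : MulChar k ℂ) (x : Trunc k c) :
    tame c hc θ x = if IsUnit x then θ (coeffAt c 0 x) else 0 := rfl

/-- **The tame characters are shallow** (`Shallow ψ̃ I χ`, `PeriodCloserC7Stability.lean`) on `I = (ϖ^m)`,
`m ≤ c − 1` (`c ≥ 1`, `ψ₀` primitive): a unit `u` with `ψ̃((u − 1) z) = 1` for all `z ∈ I` has `u₀ = 1`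
(take `z = t ϖ^{c−1}`), so `θ(u₀) = 1`. -/
theorem shallow_tame (hc : 0 < c) (θ : MulChar k ℂ) (ψ₀ : AddChar k ℂ) (h₀ : ψ₀.IsPrimitive) (piVal : ℂ)
    (m : ℕ) (hm : m ≤ c - 1) :
    LocalChar.Shallow (psiTilde c ψ₀) (Ideal.span {(varpi c : Trunc k c) ^ m})
      (⟨tame c hc θ, piVal⟩ : LocalChar (Trunc k c)) := by
  intro u hu
  have h0 : coeffAt c 0 ((u : Trunc k c) - 1) = 0 := by
    by_contra hne
    apply h₀ hne
    ext t
    rw [AddChar.mulShift_apply, AddChar.one_apply]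
    have hz : algebraMap k (Trunc k c) t * varpi c ^ (c - 1) ∈ Ideal.span {(varpi c : Trunc k c) ^ m} := by
      rw [Ideal.mem_span_singleton]
      obtain ⟨e, he⟩ : ∃ e, c - 1 = m + e := ⟨c - 1 - m, by omega⟩
      exact ⟨algebraMap k (Trunc k c) t * varpi c ^ e, by rw [he, pow_add]; ring⟩
    have key := hu _ hz
    rw [psiTilde_apply, show ((u : Trunc k c) - 1) * (algebraMap k (Trunc k c) t * varpi c ^ (c - 1)) =
      (algebraMap k (Trunc k c) t * ((u : Trunc k c) - 1)) * varpi c ^ (c - 1) by ring,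
      coeffAt_mul_varpi_pow c hc, ← Algebra.smul_def, map_smul, smul_eq_mul] at key
    rw [mul_comm]
    exact key
  rw [tame_apply, if_pos u.isUnit]
  rw [map_sub, coeffAt_zero_one c hc, sub_eq_zero] at h0
  rw [h0, MulChar.map_one]

/-! ### (E3) at `𝔭 | 5` for the tame lines twisted by the explicit twist -/

/-- **(E3) at `𝔭₁, 𝔭₂ | 5` for four tame lines twisted by the explicit twist, from N2** — `E3_of_N2_trunc`
(`OcticCMPointTruncModel.lean`, gen 1's stability) with its hypotheses `hρ`, `hχ` DISCHARGED by
`primitive_twist` and `shallow_tame`: on `I = (ϖ^m)`, `c ≤ 2m ≤ 2(c − 1)`, for `χ′_j = ⟨tame θ_j, ϖ_j⟩` and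
`ρ = ⟨twist θ_ρ ψ₀, ϖ_ρ⟩`, `χ′₀χ′₁ = χ′₂χ′₃` gives `ε(χ′₀ρ) ε(χ′₁ρ) = ε(χ′₂ρ) ε(χ′₃ρ)`. -/
theorem E3_twisted_tame [Fintype k] (hc : 2 ≤ c) (hc4 : c ≤ 4) (h2 : (2 : k) ≠ 0) (h3 : (3 : k) ≠ 0)
    (ψ₀ : AddChar k ℂ) (h₀ : ψ₀.IsPrimitive) (κ : ℂ) (n : ℕ) (θρ : MulChar k ℂ) (πρ : ℂ)
    (θ : Fin 4 → MulChar k ℂ) (π : Fin 4 → ℂ) (m : ℕ) (hm : c ≤ 2 * m) (hm' : m ≤ c - 1)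
    (hN2 : (⟨tame c (by omega) (θ 0), π 0⟩ : LocalChar (Trunc k c)) * ⟨tame c (by omega) (θ 1), π 1⟩ =
      (⟨tame c (by omega) (θ 2), π 2⟩ : LocalChar (Trunc k c)) * ⟨tame c (by omega) (θ 3), π 3⟩) :
    LocalChar.eps κ n ((⟨tame c (by omega) (θ 0), π 0⟩ : LocalChar (Trunc k c)) *
        ⟨twist c (by omega) hc4 h2 h3 θρ ψ₀, πρ⟩) (psiTilde c ψ₀) *
      LocalChar.eps κ n ((⟨tame c (by omega) (θ 1), π 1⟩ : LocalChar (Trunc k c)) *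
        ⟨twist c (by omega) hc4 h2 h3 θρ ψ₀, πρ⟩) (psiTilde c ψ₀) =
    LocalChar.eps κ n ((⟨tame c (by omega) (θ 2), π 2⟩ : LocalChar (Trunc k c)) *
        ⟨twist c (by omega) hc4 h2 h3 θρ ψ₀, πρ⟩) (psiTilde c ψ₀) *
      LocalChar.eps κ n ((⟨tame c (by omega) (θ 3), π 3⟩ : LocalChar (Trunc k c)) *
        ⟨twist c (by omega) hc4 h2 h3 θρ ψ₀, πρ⟩) (psiTilde c ψ₀) :=
  E3_of_N2_trunc c κ n (fun j => ⟨tame c (by omega) (θ j), π j⟩) _ ψ₀ m hm 1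
    (primitive_twist c (by omega) hc4 h2 h3 θρ ψ₀ πρ m hm (by omega))
    (fun j => shallow_tame c (by omega) (θ j) ψ₀ h₀ (π j) m hm') hN2

/-- **(E3) at a place of `S₃` of a face, from the explicit twist** (gen 1's `E3At_of_model` with `hρ`, `hχ`
discharged): if the face's four local signs at `v` are the model's ε-factors of the tame lines
`χ′_j = ⟨tame θ_j, π_j⟩` twisted by `ρ = ⟨twist θ_ρ ψ₀, π_ρ⟩` on `𝒪/𝔭^c` (`2 ≤ c ≤ 4`, `c ≤ 2m ≤ 2(c − 1)`) and
N2 holds, then `E3At I v d` — the hypothesis `he` is the identification of the face's signs with the model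
values (the sealed vocabulary), the only input left. -/
theorem E3At_of_twist {L : Type} [Field L] [NumberField L] [NumberField.IsCMField L] [Fintype k] (I : C7Face L)
    (v : I.Place) (d : I.Datum) (hc : 2 ≤ c) (hc4 : c ≤ 4) (h2 : (2 : k) ≠ 0) (h3 : (3 : k) ≠ 0)
    (ψ₀ : AddChar k ℂ) (h₀ : ψ₀.IsPrimitive) (κ : ℂ) (n : ℕ) (θρ : MulChar k ℂ) (πρ : ℂ)
    (θ : Fin 4 → MulChar k ℂ) (π : Fin 4 → ℂ) (m : ℕ) (hm : c ≤ 2 * m) (hm' : m ≤ c - 1)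
    (hN2 : (⟨tame c (by omega) (θ 0), π 0⟩ : LocalChar (Trunc k c)) * ⟨tame c (by omega) (θ 1), π 1⟩ =
      (⟨tame c (by omega) (θ 2), π 2⟩ : LocalChar (Trunc k c)) * ⟨tame c (by omega) (θ 3), π 3⟩)
    (he : ∀ j, ((I.localRootNumber v (I.chars d j) : ℤ) : ℂ) =
      LocalChar.eps κ n ((⟨tame c (by omega) (θ j), π j⟩ : LocalChar (Trunc k c)) *
        ⟨twist c (by omega) hc4 h2 h3 θρ ψ₀, πρ⟩) (psiTilde c ψ₀)) :
    E3At I v d :=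
  E3At_of_model I v d κ n (fun j => ⟨tame c (by omega) (θ j), π j⟩) _ (psiTilde c ψ₀) _
    (pow_mul_eq_zero_of_le c m hm) 1 (primitive_twist c (by omega) hc4 h2 h3 θρ ψ₀ πρ m hm (by omega))
    (fun j => shallow_tame c (by omega) (θ j) ψ₀ h₀ (π j) m hm') hN2 he

end TruncModel

end Summit.Ventures.HodgeRepro.PeriodCloser

end
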